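import Summits.MatrixMultiplication.MatrixMultiplication.Theorems.SoloInformedConverseDoorAllLevels
import Summits.MatrixMultiplication.MatrixMultiplication.Theorems.SoloInformedFlatteningDegen
import HarnessLib

/-!
# The converse door, formats: `⟨k,m,n⟩ ⊵ T^{⊠N}` forces `(kmn)² > 27^N` over every field

Solo seat `solo-MatrixMultiplication-informed` (generation 28).  Theorem C of the seat's
converse-door paper, now over an ARBITRARY field and in the kernel: if a matrix multiplication
tensor `⟨k,m,n⟩` (formats `kn`, `km`, `mn` in the tree's indexing) degenerates — Alman's
`PolyDegeneratesTo` — to a Kronecker power `T^{⊠N}` of `T ∈ {T_{cw,2}, T_{skewcw,2}, P}`, then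
`kn, km, mn ≥ 3^N` and `(kmn)² > 3^{3N}` STRICTLY (`converseDoor_formats_cwTwo / _skewCwTwo /
_sThree`).  So an embedding of `T^{⊠N}` into matrix multiplication certifies at best
`R̃(T) ≤ (kmn)^{ω/(3N)}` with `(kmn)^{1/(3N)} > √3`, never `R̃(T) ≤ 3^{ω/2}`, at any finite level
and in any characteristic; the flattening-tight level `k = m = n = 3^{N/2}` is the door-like support
theorem of `SoloInformedConverseDoorAllLevels`.

Ingredients, all elementary: (1) (`SoloInformedFlatteningDegen`) the first flattening is
functorial under substitutions, hence its rank is monotone along a polynomial degeneration in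
every characteristic and bounded by the number of rows; legs 2 and 3 by permuting the legs of a
degeneration;
(2) a door-like tensor is concise in legs 1 and 2 (`rank_flatA_of_doorLike`,
`rank_flatA_swap_of_doorLike`: a full-rank "monomial" square submatrix), and the three door
tensors and their Kronecker powers are concise in leg 3 (`ThirdLeg`, decided on `{0,1,2}` and
inherited); (3) the arithmetic of the
tight case (`kn = km = mn = 3^N ⟹ k = m = n`) and `SoloInformedConverseDoorAllLevels`.

## References
* A. Conner, F. Gesmundo, J. M. Landsberg, E. Ventura, *Rank and border rank of Kronecker powers
  of tensors and Strassen's laser method*, comput. complexity 31 (2022), arXiv:1909.04785, §2.3,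
  §3.2. [ConnerGesmundoLandsbergVentura2022]
* J. Alman, *Limits on the universal method for matrix multiplication*, Theory of Computing 17
  (2021), §2.4. [Alman2021]
* J. M. Landsberg, G. Ottaviani, *New lower bounds for the border rank of matrix
  multiplication*, Theory of Computing 11 (2015), Thm 2.1 (semicontinuity of flattening ranks).
  [LandsbergOttaviani2015]
-/

open scoped BigOperators Polynomial Kronecker

namespace Summit.MatrixMultiplication.MatrixMultiplication.Theorems

open Matrix Finset Module
open Literature.Computability.AlgebraicComplexity Literature.Barriers.MatrixMultiplication

universe u

set_option linter.unusedSectionVars false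

namespace ConverseDoorFormats

open OrbitRankGen ConverseDoorAll FlatDegen

/-! ## Door-like tensors are concise in legs 1 and 2; the third leg -/

section Concise

variable {ι : Type} [Fintype ι] [DecidableEq ι] {F : Type u} [Field F]

/-- **A door-like tensor is concise in the first leg**: choosing for every `a` a support point
`(a, b_a, c_a)`, the columns `(b_a, c_a)` of `flatA T` form a diagonal matrix with non-zero diagonal
(uniqueness of the first index over `(b, c)`). [cite: ConnerGesmundoLandsbergVentura2022, §3.2] -/
theorem rank_flatA_of_doorLike {T : ι → ι → ι → F} (hT : DoorLike T) :
    (flatA T).rank = Fintype.card ι := by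
  classical
  choose fb fc fc' hf using hT.link₁
  refine rank_eq_card_of_mul_eq_diagonal (flatA T)
    (fun bc a => if bc = (fb a a, fc a a) then 1 else 0) (fun a => T a (fb a a) (fc a a))
    (fun a => (hf a a).1) ?_
  ext a' a
  simp only [Matrix.mul_apply, flatA_apply, mul_ite, mul_one, mul_zero, Finset.sum_ite_eq',
    Finset.mem_univ, if_true, Matrix.diagonal_apply]
  by_cases h : a' = a
  · subst h; simp
  · rw [if_neg h]
    by_contra hne
    exact h (hT.uniq₁ _ _ _ _ hne (hf a a).1)

/-- **A door-like tensor is concise in the second leg.**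
[cite: ConnerGesmundoLandsbergVentura2022, §3.2] -/
theorem rank_flatA_swap_of_doorLike {T : ι → ι → ι → F} (hT : DoorLike T) :
    (flatA fun b a c => T a b c).rank = Fintype.card ι := by
  classical
  choose ga gc hg using hT.link₂
  refine rank_eq_card_of_mul_eq_diagonal (flatA fun b a c => T a b c)
    (fun ac b => if ac = (ga b, gc b) then 1 else 0) (fun b => T (ga b) b (gc b))
    (fun b => hg b) ?_
  ext b' b
  simp only [Matrix.mul_apply, flatA_apply, mul_ite, mul_one, mul_zero, Finset.sum_ite_eq',
    Finset.mem_univ, if_true, Matrix.diagonal_apply]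
  by_cases h : b' = b
  · subst h; simp
  · rw [if_neg h]
    by_contra hne
    exact h (hT.uniq₂ _ _ _ _ hne (hg b))

/-- **Conciseness data for the third leg** (a proof-carrying record, like `DoorLike`): every third
index occurs in the support, and it is unique over the first two.  (Not part of `DoorLike`, whose
two-leg argument does not need it.) [cite: ConnerGesmundoLandsbergVentura2022, §3.2] -/
structure ThirdLeg {R : Type*} [Zero R] (T : ι → ι → ι → R) : Type where
  /-- every `c` occurs in the support -/
  occ : ∀ c, ∃ a b, T a b c ≠ 0
  /-- the third index is unique over the first two -/
  uniq : ∀ a b q q', T a b q ≠ 0 → T a b q' ≠ 0 → q = q'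

/-- `ThirdLeg` survives reading a `{0, ±1}`-valued integer tensor in any field. [folklore] -/
noncomputable def ThirdLeg.intCast {tZ : ι → ι → ι → ℤ} (h : ThirdLeg tZ)
    (hu : ∀ a b c, tZ a b c = 0 ∨ tZ a b c = 1 ∨ tZ a b c = -1) :
    ThirdLeg (fun a b c => (tZ a b c : F)) := by
  have hiff : ∀ a b c, ((tZ a b c : F) ≠ 0 ↔ tZ a b c ≠ 0) := fun a b c => by
    rcases hu a b c with h | h | h <;> simp [h]
  refine ⟨fun c => ?_, fun a b q q' hq hq' => h.uniq a b q q' ((hiff _ _ _).1 hq)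
    ((hiff _ _ _).1 hq')⟩
  obtain ⟨a, b, h1⟩ := h.occ c
  exact ⟨a, b, (hiff _ _ _).2 h1⟩

/-- `ThirdLeg` is inherited by Kronecker powers. [cite: ConnerGesmundoLandsbergVentura2022, §3.1] -/
noncomputable def ThirdLeg.kroneckerPow {t : ι → ι → ι → F} (ht : ThirdLeg t) (N : ℕ) :
    ThirdLeg (kroneckerPow t N) := by
  classical
  choose ga gb hg using ht.occ
  refine ⟨fun c => ⟨fun j => ga (c j), fun j => gb (c j), ?_⟩, fun a b q q' hq hq' => ?_⟩
  · rw [kroneckerPow_apply, Finset.prod_ne_zero_iff]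
    exact fun j _ => hg (c j)
  · rw [kroneckerPow_apply, Finset.prod_ne_zero_iff] at hq hq'
    funext i
    exact ht.uniq _ _ _ _ (hq i (Finset.mem_univ _)) (hq' i (Finset.mem_univ _))

/-- **A tensor with `ThirdLeg` data is concise in the third leg.**
[cite: ConnerGesmundoLandsbergVentura2022, §3.2] -/
theorem ThirdLeg.rank_flatA_rot {T : ι → ι → ι → F} (hT : ThirdLeg T) :
    (flatA fun c a b => T a b c).rank = Fintype.card ι := by
  classical
  choose ga gb hg using hT.occ
  refine rank_eq_card_of_mul_eq_diagonal (flatA fun c a b => T a b c)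
    (fun ab c => if ab = (ga c, gb c) then 1 else 0) (fun c => T (ga c) (gb c) c)
    (fun c => hg c) ?_
  ext c' c
  simp only [Matrix.mul_apply, flatA_apply, mul_ite, mul_one, mul_zero, Finset.sum_ite_eq',
    Finset.mem_univ, if_true, Matrix.diagonal_apply]
  by_cases h : c' = c
  · subst h; simp
  · rw [if_neg h]
    by_contra hne
    exact h (hT.uniq _ _ _ _ hne (hg c))

/-- `T_{cw,2}` over `ℤ`: third-leg data (decided).
[cite: ConnerGesmundoLandsbergVentura2022, §3.2] -/
def thirdLeg_cwTwoInt : ThirdLeg CayleyOmega.cwTwoInt := ⟨by decide, by decide⟩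

/-- `T_{cw,2}`: third-leg data over every field. [cite: ConnerGesmundoLandsbergVentura2022, §3.2] -/
noncomputable def thirdLeg_cwTensor_two : ThirdLeg (cwTensor F 2) := by
  rw [CayleyOmega.cwTensor_two_eq_cast]
  exact thirdLeg_cwTwoInt.intCast cwTwoInt_mem

/-- `T_{skewcw,2}` over `ℤ`: third-leg data. [cite: ConnerGesmundoLandsbergVentura2022, §3.2] -/
def thirdLeg_skewTwoZ : ThirdLeg skewTwoZ := ⟨by decide, by decide⟩

/-- `T_{skewcw,2}`: third-leg data over every field.
[cite: ConnerGesmundoLandsbergVentura2022, §3.2] -/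
noncomputable def thirdLeg_skewCwTensor_one : ThirdLeg (skewCwTensor F 1) := by
  rw [skewCwTensor_one_eq_cast_skewTwoZ]
  exact thirdLeg_skewTwoZ.intCast skewTwoZ_mem

/-- `P` over `ℤ`: third-leg data. [cite: ConnerGesmundoLandsbergVentura2022, §3.2] -/
def thirdLeg_sThreeInt : ThirdLeg sThreeInt := ⟨by decide, by decide⟩

/-- `P`: third-leg data over every field. [cite: ConnerGesmundoLandsbergVentura2022, §3.2] -/
noncomputable def thirdLeg_sThree : ThirdLeg (sThree F) :=
  thirdLeg_sThreeInt.intCast sThreeInt_mem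

end Concise

/-! ## Formats of a matrix multiplication tensor degenerating to a door-like tensor -/

section Formats

variable {K : Type u} [Field K]

/-- **The three flattening inequalities**: if `⟨k,m,n⟩ ⊵ T` with `T` door-like with third-leg data
on an index set of size `d`, then `d ≤ kn`, `d ≤ km`, `d ≤ mn` (every field).
[cite: ConnerGesmundoLandsbergVentura2022, §2.3] -/
theorem formats_of_matMul_polyDegeneratesTo {J : Type} [Fintype J] [DecidableEq J]
    {T : J → J → J → K} (hT : DoorLike T) (h3 : ThirdLeg T) (k m n : ℕ)
    (h : PolyDegeneratesTo (matMulTensor K k m n) T) :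
    Fintype.card J ≤ k * n ∧ Fintype.card J ≤ k * m ∧ Fintype.card J ≤ m * n := by
  refine ⟨?_, ?_, ?_⟩
  · simpa using card_le_of_polyDegeneratesTo h (rank_flatA_of_doorLike hT)
  · simpa using card_le_of_polyDegeneratesTo (polyDegeneratesTo_swap h)
      (rank_flatA_swap_of_doorLike hT)
  · simpa using card_le_of_polyDegeneratesTo (polyDegeneratesTo_rot h) h3.rank_flatA_rot

/-- The arithmetic of the flattening inequalities: `d ≤ kn, km, mn ⟹ d³ ≤ (kmn)²`. [folklore] -/
theorem cube_le_sq_of_formats {d k m n : ℕ} (h1 : d ≤ k * n) (h2 : d ≤ k * m) (h3 : d ≤ m * n) :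
    d ^ 3 ≤ (k * m * n) ^ 2 := by
  calc d ^ 3 = d * d * d := by ring
    _ ≤ (k * n) * (k * m) * (m * n) := Nat.mul_le_mul (Nat.mul_le_mul h1 h2) h3
    _ = (k * m * n) ^ 2 := by ring

/-- The tight case: `d ≤ kn, km, mn`, `d ≥ 1` and `(kmn)² = d³` force `k = m = n` and `k² = d`.
[folklore] -/
theorem tight_of_formats {d k m n : ℕ} (hd : 1 ≤ d) (h1 : d ≤ k * n) (h2 : d ≤ k * m)
    (h3 : d ≤ m * n) (he : (k * m * n) ^ 2 = d ^ 3) : k = m ∧ m = n ∧ k * k = d := by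
  have hsq : (k * m * n) ^ 2 = (k * n) * (k * m) * (m * n) := by ring
  have hkn : k * n = d := by
    by_contra hne
    have hlt : d + 1 ≤ k * n := by omega
    have := Nat.mul_le_mul (Nat.mul_le_mul hlt h2) h3
    rw [← hsq, he] at this
    nlinarith
  have hkm : k * m = d := by
    by_contra hne
    have hlt : d + 1 ≤ k * m := by omega
    have := Nat.mul_le_mul (Nat.mul_le_mul h1 hlt) h3
    rw [← hsq, he] at this
    nlinarith
  have hmn : m * n = d := by
    by_contra hne
    have hlt : d + 1 ≤ m * n := by omega
    have := Nat.mul_le_mul (Nat.mul_le_mul h1 h2) hlt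
    rw [← hsq, he] at this
    nlinarith
  have hk : 0 < k := Nat.pos_of_ne_zero fun hk => by subst hk; omega
  have hm : 0 < m := Nat.pos_of_ne_zero fun hm => by subst hm; omega
  have hnm : n = m := Nat.eq_of_mul_eq_mul_left hk (hkn.trans hkm.symm)
  have hmk : m * k = m * n := by rw [Nat.mul_comm m k, hkm, hmn]
  have hkn' : k = n := Nat.eq_of_mul_eq_mul_left hm hmk
  have hkm' : k = m := hkn'.trans hnm
  refine ⟨hkm', hnm.symm, ?_⟩
  rw [← hkm'] at hkm
  exact hkm

/-- `q² = 3^N` with `N ≥ 1` forces `q ≥ 2`. [folklore] -/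
theorem two_le_of_sq_eq_three_pow {q N : ℕ} (hN : 1 ≤ N) (hq : q * q = 3 ^ N) : 2 ≤ q := by
  by_contra hlt
  have hq1 : q ≤ 1 := by omega
  have h3 : 3 ≤ 3 ^ N := by
    calc 3 = 3 ^ 1 := by norm_num
      _ ≤ 3 ^ N := Nat.pow_le_pow_right (by norm_num) hN
  have : q * q ≤ 1 := by nlinarith
  omega

/-- **The general format theorem**: if `⟨k,m,n⟩ ⊵ T₀^{⊠N}` over a field, where `T₀` on `{0,1,2}` is
door-like with third-leg data and `⟨q,q,q⟩ ⋭ T₀^{⊠N}` whenever `q² = 3^N`, `q ≥ 2`, then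
`3^N ≤ kn, km, mn` and `3^{3N} < (kmn)²`. [cite: ConnerGesmundoLandsbergVentura2022, §2.3] -/
theorem formats_pow {T₀ : Fin 3 → Fin 3 → Fin 3 → K} (hT : DoorLike T₀) (h3 : ThirdLeg T₀)
    (htight : ∀ q N : ℕ, 2 ≤ q → 3 ^ N = q * q →
      ¬ PolyDegeneratesTo (matMulTensor K q q q) (kroneckerPow T₀ N))
    (k m n N : ℕ) (hN : 1 ≤ N)
    (h : PolyDegeneratesTo (matMulTensor K k m n) (kroneckerPow T₀ N)) :
    3 ^ N ≤ k * n ∧ 3 ^ N ≤ k * m ∧ 3 ^ N ≤ m * n ∧ 3 ^ (3 * N) < (k * m * n) ^ 2 := by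
  obtain ⟨h1, h2, h3'⟩ :=
    formats_of_matMul_polyDegeneratesTo (hT.kroneckerPow N) (h3.kroneckerPow N) k m n h
  have hc : Fintype.card (Fin N → Fin 3) = 3 ^ N := by simp
  rw [hc] at h1 h2 h3'
  refine ⟨h1, h2, h3', ?_⟩
  have hle : (3 ^ N) ^ 3 ≤ (k * m * n) ^ 2 := cube_le_sq_of_formats h1 h2 h3'
  rw [← pow_mul, Nat.mul_comm N 3] at hle
  rcases hle.lt_or_eq with hlt | heq
  · exact hlt
  · exfalso
    rw [Nat.mul_comm 3 N, pow_mul] at heq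
    obtain ⟨hkm, hmn, hkk⟩ := tight_of_formats (Nat.one_le_pow _ _ (by norm_num)) h1 h2 h3' heq.symm
    subst hkm
    subst hmn
    exact htight k N (two_le_of_sq_eq_three_pow hN hkk) hkk.symm h

/-- **Theorem C for `T_{cw,2}`, every field**: `⟨k,m,n⟩ ⊵ T_{cw,2}^{⊠N}` (`N ≥ 1`) forces
`kn, km, mn ≥ 3^N` and `(kmn)² > 3^{3N}` — no Kronecker power of the door tensor is a degeneration
of a matrix multiplication tensor of flattening-tight size, in any characteristic.
[cite: ConnerGesmundoLandsbergVentura2022, §2.3] -/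
theorem converseDoor_formats_cwTwo (k m n N : ℕ) (hN : 1 ≤ N)
    (h : PolyDegeneratesTo (matMulTensor K k m n) (kroneckerPow (cwTensor K 2) N)) :
    3 ^ N ≤ k * n ∧ 3 ^ N ≤ k * m ∧ 3 ^ N ≤ m * n ∧ 3 ^ (3 * N) < (k * m * n) ^ 2 :=
  formats_pow doorLike_cwTensor_two thirdLeg_cwTensor_two
    (fun q N hq hqN => not_matMul_polyDegeneratesTo_cwTwo_pow q N hq hqN) k m n N hN h

/-- **Theorem C for `T_{skewcw,2}`, every field.**
[cite: ConnerGesmundoLandsbergVentura2022, §2.3] -/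
theorem converseDoor_formats_skewCwTwo (k m n N : ℕ) (hN : 1 ≤ N)
    (h : PolyDegeneratesTo (matMulTensor K k m n) (kroneckerPow (skewCwTensor K 1) N)) :
    3 ^ N ≤ k * n ∧ 3 ^ N ≤ k * m ∧ 3 ^ N ≤ m * n ∧ 3 ^ (3 * N) < (k * m * n) ^ 2 :=
  formats_pow doorLike_skewCwTensor_one thirdLeg_skewCwTensor_one
    (fun q N hq hqN => not_matMul_polyDegeneratesTo_skewCwTwo_pow q N hq hqN) k m n N hN h

/-- **Theorem C for `P`, every field.** [cite: ConnerGesmundoLandsbergVentura2022, §2.3] -/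
theorem converseDoor_formats_sThree (k m n N : ℕ) (hN : 1 ≤ N)
    (h : PolyDegeneratesTo (matMulTensor K k m n) (kroneckerPow (sThree K) N)) :
    3 ^ N ≤ k * n ∧ 3 ^ N ≤ k * m ∧ 3 ^ N ≤ m * n ∧ 3 ^ (3 * N) < (k * m * n) ^ 2 :=
  formats_pow doorLike_sThree thirdLeg_sThree
    (fun q N hq hqN => not_matMul_polyDegeneratesTo_sThree_pow q N hq hqN) k m n N hN h

end Formats

end ConverseDoorFormats

end Summit.MatrixMultiplication.MatrixMultiplication.Theorems
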